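import Mathlib.LinearAlgebra.Dual.Lemmas
import Mathlib.Algebra.Group.Subgroup.Basic
import Mathlib.GroupTheory.Perm.Basic
import HarnessLib

/-!
# A sign-isotypic linear form lying in the span of a permutation family of linear forms forces the sign
# character to be trivial on some stabiliser (Frobenius reciprocity for a quadratic character against a
# permutation module, linear-form version)

Layer `Literature/RepresentationTheory/FiniteGroups`, namespace `Literature.RepresentationTheory.FiniteGroups`;
lane `lit-hodgefound` (Track 2 foundations library), prover seat `lit-hodgefound-p17` (generation 44, self-proposed
row g44-#1).  THEOREMS ONLY (3 public + 4 private; no definition, no instance, no notation, no named fact; net debt 0).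

## The statement

Let a group `G` act on a finite set `I` through `π : G →* Perm I` and on an `F`-vector space `W` through arbitrary
`F`-linear maps `ρ g` (`F` a field of characteristic `0`; no homomorphism property of `ρ` is needed), and let
`λ_i : W → F` (`i ∈ I`) be linear forms PERMUTED by the action,

  `λ_i (ρ g w) = λ_{(π g)⁻¹ i} (w)`.

Suppose two marked indices `iP ≠ iM` form a `G`-stable pair on which `G` acts through a SIGN (`π g` either fixes both or
swaps them) and carry opposite forms `λ_{iM} = -λ_{iP}` — so that `λ_{iP} ∘ ρ g = ε(g) λ_{iP}` with `ε(g) = ±1` the sign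
of `g` on the pair.  If the non-zero form `λ_{iP}` lies in the `F`-span of the forms `λ_j`, `j ∈ J`, for a `G`-stable
subset `J ⊆ I`, then SOME `j ∈ J` has the property that every `g ∈ G` fixing `j` fixes `iP`:

  `∃ j ∈ J, ∀ g, π g j = j → π g iP = iP`

(`exists_mem_forall_apply_eq_of_mem_span`; kernel form `exists_mem_forall_apply_eq_of_forall_eq_zero`:
the span hypothesis replaced by «`λ_j w = 0` for all `j ∈ J` implies `λ_{iP} w = 0`»; contrapositive
`eq_zero_of_mem_span_of_forall_exists`).

This is the linear-algebra content of Frobenius reciprocity for the permutation module `F[J] = ⊕_{orbits} Ind_{Stab}^G 1`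
against the quadratic character `ε`: `Hom_G(F[G/H], ε) = Hom_H(1, ε|_H)` is non-zero only if `ε` is trivial on `H`
(Serre, *Linear Representations of Finite Groups*, §7.2 Prop. 21 / Thm. 13).  PROOF (averaging): the image
`Ḡ = π(G) ≤ Perm I` is finite; summing `ε(p) · λ_{iP} ∘ ρ(g_p)` over `p ∈ Ḡ` (any preimages `g_p`) gives `|Ḡ| · λ_{iP}` on
one hand, and on the other hand `∑_j c_j ∑_p ε(p) λ_{p⁻¹ j}`; if every `j ∈ J` is «bad» (some `q_j ∈ Ḡ` fixes `j` and
moves `iP`), each fibre sum `∑_{p ∈ Ḡ, p j' = j} ε(p)` vanishes, being reversed in sign by `p ↦ p q_{j'}` — whence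
`λ_{iP} = 0`.

## Why it is here (consumer)

It is the combinatorial heart of B. Moonen, Yu. G. Zarhin, *Hodge classes on abelian varieties of low dimension*,
Math. Ann. 315 (1999), §3 Prop. (3.8) (held `paper:arxiv-math_9901113`, p0007 L44–L63): «Suppose […]
`Hg(X × E) ≠ Hg(X) × Hg(E)` […] there is a homomorphism `U_k → U_{F_1} × ⋯ × U_{F_n}` with finite kernel. If `U_{F_i}`
is a factor such that the projection of `U_k` to `U_{F_i}` has rank 1 then it easily follows from Lemma (3.7) that there
exists an embedding `k → F_i`.»  Read on cocharacters: the character lattice of `U_{F_1} × ⋯ × U_{F_n}` is a quotient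
of the permutation module on the complex embeddings `J = ⊔ Hom(F_i, ℂ)` of the centre of `End⁰(X)`, the character of
`U_k` spans the sign representation `ε` of `Gal` attached to the imaginary quadratic field `k` (the two embeddings
`iP, iM` of `k`), «finite kernel» puts `ε` inside the span of the `λ_j`, and the conclusion «every automorphism fixing
the embedding `j : F_i → ℂ` fixes `√-d`» is `k ⊆ j(F_i)` by Galois theory.  That assembly is the business of the sequel
(`Literature/Geometry/Kaehler/…`); this file is field- and group-agnostic.

## References

* [Serre1977] J.-P. Serre, *Linear Representations of Finite Groups*, GTM 42 (1977), §3.3 (permutation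
  representations), §7.2 (Frobenius reciprocity).
* [MoonenZarhin1999LowDim] B. Moonen, Yu. G. Zarhin, Math. Ann. 315 (1999), §3, proof of Prop. (3.8).
-/

namespace Literature.RepresentationTheory.FiniteGroups

open Finset

variable {F : Type*} [Field F] [CharZero F]
variable {G : Type*} [Group G] {I : Type*} [Fintype I] [DecidableEq I]
variable {W : Type*} [AddCommGroup W] [Module F W]

/-! ### §1 The sign of a permutation on a stable pair -/

section Sign

variable {iP iM : I}

omit [CharZero F] [Fintype I] in
/-- On a stable pair `{iP, iM}` (each of `p`, `q` fixes both points or swaps them) the sign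
`ε(p) = if p iP = iP then 1 else -1` is multiplicative: `ε(p q) = ε(p) ε(q)`. [folklore] -/
private theorem sign_mul_of_pair (hne : iP ≠ iM) {p q : Equiv.Perm I}
    (hp : (p iP = iP ∧ p iM = iM) ∨ (p iP = iM ∧ p iM = iP))
    (hq : (q iP = iP ∧ q iM = iM) ∨ (q iP = iM ∧ q iM = iP)) :
    (if (p * q) iP = iP then (1 : F) else -1) =
      (if p iP = iP then (1 : F) else -1) * (if q iP = iP then (1 : F) else -1) := by
  rcases hp with ⟨hp₁, hp₂⟩ | ⟨hp₁, hp₂⟩ <;> rcases hq with ⟨hq₁, hq₂⟩ | ⟨hq₁, hq₂⟩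
  · have h : (p * q) iP = iP := by rw [Equiv.Perm.mul_apply, hq₁, hp₁]
    rw [if_pos h, if_pos hp₁, if_pos hq₁, one_mul]
  · have h : (p * q) iP ≠ iP := by rw [Equiv.Perm.mul_apply, hq₁, hp₂]; exact hne.symm
    have h' : q iP ≠ iP := by rw [hq₁]; exact hne.symm
    rw [if_neg h, if_pos hp₁, if_neg h', one_mul]
  · have h : (p * q) iP ≠ iP := by rw [Equiv.Perm.mul_apply, hq₁, hp₁]; exact hne.symm
    have h' : p iP ≠ iP := by rw [hp₁]; exact hne.symm
    rw [if_neg h, if_neg h', if_pos hq₁, mul_one]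
  · have h : (p * q) iP = iP := by rw [Equiv.Perm.mul_apply, hq₁, hp₂]
    have h' : p iP ≠ iP := by rw [hp₁]; exact hne.symm
    have h'' : q iP ≠ iP := by rw [hq₁]; exact hne.symm
    rw [if_pos h, if_neg h', if_neg h'']
    norm_num

omit [Fintype I] [DecidableEq I] in
/-- The inverse of a permutation fixing-or-swapping the pair `{iP, iM}` sends `iP` to `iP` when `p` fixes `iP`.
[folklore] -/
private theorem symm_apply_eq_of_pair_of_eq {p : Equiv.Perm I} (hp : p iP = iP) : p⁻¹ iP = iP := by
  rw [Equiv.Perm.inv_def, Equiv.symm_apply_eq]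
  exact hp.symm

omit [Fintype I] [DecidableEq I] in
/-- The inverse of a permutation swapping the pair `{iP, iM}` sends `iP` to `iM`. [folklore] -/
private theorem symm_apply_eq_of_pair_of_ne {p : Equiv.Perm I} (hp : p iM = iP) : p⁻¹ iP = iM := by
  rw [Equiv.Perm.inv_def, Equiv.symm_apply_eq]
  exact hp.symm

end Sign

/-! ### §2 Fibre sums of the sign vanish over a bad stabiliser -/

section Fibre

/-- **Cancellation on a fibre.** Let `S ≤ Perm I` be a subgroup on which the sign `ε` of the stable pair `{iP, iM}`
is defined (every element fixes both marked points or swaps them), and let `q ∈ S` fix `j'` and move `iP`.  Then the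
sum of `ε` over the fibre `{p ∈ S | p j' = j}` vanishes: right multiplication by `q` is a bijection of the fibre
reversing `ε`. [folklore] -/
private theorem sum_filter_sign_eq_zero {iP iM : I} (hne : iP ≠ iM) (S : Subgroup (Equiv.Perm I))
    [DecidablePred (· ∈ S)]
    (hpair : ∀ p ∈ S, (p iP = iP ∧ p iM = iM) ∨ (p iP = iM ∧ p iM = iP))
    {q : Equiv.Perm I} (hqS : q ∈ S) {j j' : I} (hqj : q j' = j') (hqi : q iP ≠ iP) :
    ∑ p ∈ (Finset.univ.filter (· ∈ S)).filter (fun p ↦ p j' = j),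
      (if p iP = iP then (1 : F) else -1) = 0 := by
  set T := (Finset.univ.filter (· ∈ S)).filter (fun p : Equiv.Perm I ↦ p j' = j) with hT
  have hmemT : ∀ p, p ∈ T ↔ p ∈ S ∧ p j' = j := fun p ↦ by simp [hT]
  -- right multiplication by `q` maps the fibre to itself
  have hmapsTo : ∀ p ∈ T, p * q ∈ T := fun p hp ↦ by
    rw [hmemT] at hp ⊢
    exact ⟨S.mul_mem hp.1 hqS, by rw [Equiv.Perm.mul_apply, hqj, hp.2]⟩
  have hmapsTo' : ∀ p ∈ T, p * q⁻¹ ∈ T := fun p hp ↦ by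
    rw [hmemT] at hp ⊢
    refine ⟨S.mul_mem hp.1 (S.inv_mem hqS), ?_⟩
    have hq' : q⁻¹ j' = j' := by rw [Equiv.Perm.inv_def, Equiv.symm_apply_eq]; exact hqj.symm
    rw [Equiv.Perm.mul_apply, hq', hp.2]
  have hsum : ∑ p ∈ T, (if p iP = iP then (1 : F) else -1) =
      ∑ p ∈ T, (if (p * q) iP = iP then (1 : F) else -1) := by
    exact (Finset.sum_nbij' (fun p ↦ p * q) (fun p ↦ p * q⁻¹) hmapsTo hmapsTo' (fun p _ ↦ by simp)
      (fun p _ ↦ by simp) (fun p _ ↦ rfl)).symm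
  have hq_sign : (if q iP = iP then (1 : F) else -1) = -1 := by simp [hqi]
  have hsum' : ∑ p ∈ T, (if (p * q) iP = iP then (1 : F) else -1) =
      -∑ p ∈ T, (if p iP = iP then (1 : F) else -1) := by
    rw [← Finset.sum_neg_distrib]
    refine Finset.sum_congr rfl fun p hp ↦ ?_
    rw [sign_mul_of_pair (F := F) hne (hpair p ((hmemT p).1 hp).1) (hpair q hqS), hq_sign, mul_neg_one]
  have h2 : (2 : F) * ∑ p ∈ T, (if p iP = iP then (1 : F) else -1) = 0 := by
    rw [two_mul]
    nth_rewrite 1 [hsum, hsum']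
    exact neg_add_cancel _
  exact (mul_eq_zero.1 h2).resolve_left two_ne_zero

end Fibre

/-! ### §3 The theorem -/

section Main

variable (π : G →* Equiv.Perm I) (ρ : G → W →ₗ[F] W) (lam : I → W →ₗ[F] F)

/-- **Contrapositive form.**  With the data of the module docstring (`π`, `ρ`, permuted forms `lam`, a sign pair
`iP ≠ iM` with `lam iM = -lam iP`, a `G`-stable `J ⊆ I` and `lam iP ∈ span_F {lam j | j ∈ J}`): if EVERY `j ∈ J` is
fixed by some `g ∈ G` moving `iP`, then `lam iP = 0`.  (Frobenius reciprocity: the `ε`-isotypic part of the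
permutation module `F[J]` is zero when `ε` is non-trivial on every stabiliser.)
[cite: Serre1977, §7.2 Prop. 21 (Frobenius reciprocity), §3.3 Example 2 (permutation representations)] -/
theorem eq_zero_of_mem_span_of_forall_exists
    (hperm : ∀ g i w, lam i (ρ g w) = lam ((π g)⁻¹ i) w)
    {iP iM : I} (hne : iP ≠ iM) (hneg : ∀ w, lam iM w = -lam iP w)
    (hpair : ∀ g, (π g iP = iP ∧ π g iM = iM) ∨ (π g iP = iM ∧ π g iM = iP))
    {J : Set I} (hJ : ∀ g, ∀ j ∈ J, π g j ∈ J)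
    (hspan : lam iP ∈ Submodule.span F (lam '' J))
    (hbad : ∀ j ∈ J, ∃ g, π g j = j ∧ π g iP ≠ iP) :
    lam iP = 0 := by
  classical
  -- (a) `lam iP ∘ ρ g = ε(g) lam iP`
  have hsgn : ∀ g w, lam iP (ρ g w) = (if π g iP = iP then (1 : F) else -1) * lam iP w := by
    intro g w
    rw [hperm]
    rcases hpair g with ⟨h₁, -⟩ | ⟨h₁, h₂⟩
    · rw [symm_apply_eq_of_pair_of_eq h₁, if_pos h₁, one_mul]
    · have h₁' : π g iP ≠ iP := by rw [h₁]; exact hne.symm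
      rw [symm_apply_eq_of_pair_of_ne h₂, if_neg h₁', hneg, neg_one_mul]
  -- (b) expansion of `lam iP` along `J`
  haveI : Fintype ↥J := Fintype.ofFinite ↥J
  have hspan' : lam iP ∈ Submodule.span F (Set.range fun j : ↥J ↦ lam (j : I)) := by
    rwa [← Set.image_eq_range]
  obtain ⟨c, hc⟩ := Submodule.mem_span_range_iff_exists_fun F |>.1 hspan'
  have hexp : ∀ w, lam iP w = ∑ j : ↥J, c j * lam (j : I) w := fun w ↦ by
    have h := congrArg (fun f : W →ₗ[F] F ↦ f w) hc
    simpa [LinearMap.sum_apply, LinearMap.smul_apply] using h.symm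
  -- (c) the finite image `Ḡ = π(G)` and a section
  set S : Subgroup (Equiv.Perm I) := π.range with hSdef
  set SF : Finset (Equiv.Perm I) := Finset.univ.filter (· ∈ S) with hSF
  have hmemSF : ∀ p, p ∈ SF ↔ p ∈ S := fun p ↦ by simp [hSF]
  have hsec : ∀ p ∈ SF, ∃ g, π g = p := fun p hp ↦ by
    have hp' : p ∈ S := (hmemSF p).1 hp
    rw [hSdef, MonoidHom.mem_range] at hp'
    exact hp'
  choose! sec hsec using hsec
  have hpairS : ∀ p ∈ S, (p iP = iP ∧ p iM = iM) ∨ (p iP = iM ∧ p iM = iP) := by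
    intro p hp
    rw [hSdef, MonoidHom.mem_range] at hp
    obtain ⟨g, rfl⟩ := hp
    exact hpair g
  -- (d) the averaged form, computed in two ways
  have hA : ∀ w, ∑ p ∈ SF, (if p iP = iP then (1 : F) else -1) * lam iP (ρ (sec p) w) =
      (SF.card : F) * lam iP w := by
    intro w
    have h1 : ∀ p ∈ SF, (if p iP = iP then (1 : F) else -1) * lam iP (ρ (sec p) w) = lam iP w := by
      intro p hp
      rw [hsgn, hsec p hp, ← mul_assoc]
      split_ifs <;> simp
    rw [Finset.sum_congr rfl h1, Finset.sum_const, nsmul_eq_mul]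
  have hB : ∀ w, ∑ p ∈ SF, (if p iP = iP then (1 : F) else -1) * lam iP (ρ (sec p) w) = 0 := by
    intro w
    -- expand `lam iP (ρ g w)` along `J` and use the permutation law
    have h1 : ∀ p ∈ SF, (if p iP = iP then (1 : F) else -1) * lam iP (ρ (sec p) w) =
        ∑ j : ↥J, c j * ((if p iP = iP then (1 : F) else -1) * lam (p⁻¹ (j : I)) w) := by
      intro p hp
      rw [hexp, Finset.mul_sum]
      refine Finset.sum_congr rfl fun j _ ↦ ?_
      rw [hperm, hsec p hp]
      ring
    rw [Finset.sum_congr rfl h1, Finset.sum_comm]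
    refine Finset.sum_eq_zero fun j _ ↦ ?_
    rw [← Finset.mul_sum]
    -- the inner sum vanishes fibrewise
    suffices hinner : ∑ p ∈ SF, (if p iP = iP then (1 : F) else -1) * lam (p⁻¹ (j : I)) w = 0 by
      rw [hinner, mul_zero]
    rw [← Finset.sum_fiberwise_of_maps_to (s := SF) (t := Finset.univ) (g := fun p : Equiv.Perm I ↦ p⁻¹ (j : I))
      (fun _ _ ↦ Finset.mem_univ _)]
    refine Finset.sum_eq_zero fun j' _ ↦ ?_
    have h2 : ∀ p ∈ SF.filter (fun p : Equiv.Perm I ↦ p⁻¹ (j : I) = j'),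
        (if p iP = iP then (1 : F) else -1) * lam (p⁻¹ (j : I)) w =
          (if p iP = iP then (1 : F) else -1) * lam j' w := by
      intro p hp
      rw [(Finset.mem_filter.1 hp).2]
    rw [Finset.sum_congr rfl h2, ← Finset.sum_mul]
    -- either the fibre is empty, or `j' ∈ J` is bad
    by_cases hj' : j' ∈ J
    · obtain ⟨g, hgj, hgi⟩ := hbad j' hj'
      have hfilter : SF.filter (fun p : Equiv.Perm I ↦ p⁻¹ (j : I) = j') =
          SF.filter (fun p : Equiv.Perm I ↦ p j' = (j : I)) := by
        refine Finset.filter_congr fun p _ ↦ ?_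
        rw [Equiv.Perm.inv_def, Equiv.symm_apply_eq, eq_comm]
      rw [hfilter, hSF, sum_filter_sign_eq_zero (F := F) hne S hpairS (q := π g) ⟨g, rfl⟩ hgj hgi, zero_mul]
    · have hempty : SF.filter (fun p : Equiv.Perm I ↦ p⁻¹ (j : I) = j') = ∅ := by
        refine Finset.filter_eq_empty_iff.2 fun p hp h ↦ hj' ?_
        obtain ⟨g, hg⟩ : ∃ g, π g = p := ⟨sec p, hsec p hp⟩
        rw [← h, ← hg, ← map_inv]
        exact hJ g⁻¹ (j : I) j.2
      rw [hempty, Finset.sum_empty, zero_mul]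
  -- (e) conclusion: `|Ḡ| · lam iP = 0` with `|Ḡ| ≠ 0`
  have hcard : (SF.card : F) ≠ 0 := by
    have h1 : (1 : Equiv.Perm I) ∈ SF := (hmemSF 1).2 S.one_mem
    exact Nat.cast_ne_zero.2 (Finset.card_pos.2 ⟨1, h1⟩).ne'
  ext w
  have h := hA w
  rw [hB w] at h
  simpa [hcard] using h.symm

/-- **Frobenius reciprocity for a sign character against a permutation module (linear-form version).**  Let `G` act on
the finite set `I` by `π` and on the `F`-space `W` by linear maps `ρ g`, permuting the linear forms `lam i`
(`lam i (ρ g w) = lam ((π g)⁻¹ i) w`).  Let `iP ≠ iM` be a pair on which every `π g` acts by fixing both or swapping,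
with `lam iM = -lam iP`, and let `J ⊆ I` be `G`-stable.  If `0 ≠ lam iP ∈ span_F {lam j | j ∈ J}` then some `j ∈ J`
has its stabiliser inside the stabiliser of `iP`: `∀ g, π g j = j → π g iP = iP`.
(In Moonen–Zarhin's Prop. (3.8): a complex embedding `j` of a simple factor `F_i` of the centre of `End⁰(X)` every
automorphism of `ℂ` over which fixes `√-d`, i.e. `k = ℚ(√-d) ⊆ j(F_i)`.)
[cite: Serre1977, §7.2 Prop. 21 (Frobenius reciprocity), §3.3 Example 2 (permutation representations)] -/
theorem exists_mem_forall_apply_eq_of_mem_span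
    (hperm : ∀ g i w, lam i (ρ g w) = lam ((π g)⁻¹ i) w)
    {iP iM : I} (hne : iP ≠ iM) (hneg : ∀ w, lam iM w = -lam iP w)
    (hpair : ∀ g, (π g iP = iP ∧ π g iM = iM) ∨ (π g iP = iM ∧ π g iM = iP))
    {J : Set I} (hJ : ∀ g, ∀ j ∈ J, π g j ∈ J)
    (hspan : lam iP ∈ Submodule.span F (lam '' J)) (hnz : lam iP ≠ 0) :
    ∃ j ∈ J, ∀ g, π g j = j → π g iP = iP := by
  by_contra h
  refine hnz (eq_zero_of_mem_span_of_forall_exists π ρ lam hperm hne hneg hpair hJ hspan fun j hj ↦ ?_)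
  by_contra h'
  exact h ⟨j, hj, fun g hg ↦ by by_contra hgi; exact h' ⟨g, hg, hgi⟩⟩

/-- **Kernel form** of `exists_mem_forall_apply_eq_of_mem_span`: the span hypothesis is replaced by «every `w`
killed by all `lam j`, `j ∈ J`, is killed by `lam iP`» (equivalent for finitely many forms over a field,
Mathlib `mem_span_of_iInf_ker_le_ker`).  In Moonen–Zarhin's Prop. (3.8) this is the «finite kernel» of
`Hg(X × E) → Hg(X)` read on Lie algebras: a central element whose `X`-block has all eigenvalues `0` is `0`.
[cite: MoonenZarhin1999LowDim, §3 Prop. (3.8), proof] -/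
theorem exists_mem_forall_apply_eq_of_forall_eq_zero
    (hperm : ∀ g i w, lam i (ρ g w) = lam ((π g)⁻¹ i) w)
    {iP iM : I} (hne : iP ≠ iM) (hneg : ∀ w, lam iM w = -lam iP w)
    (hpair : ∀ g, (π g iP = iP ∧ π g iM = iM) ∨ (π g iP = iM ∧ π g iM = iP))
    {J : Set I} (hJ : ∀ g, ∀ j ∈ J, π g j ∈ J)
    (hker : ∀ w, (∀ j ∈ J, lam j w = 0) → lam iP w = 0) (hnz : lam iP ≠ 0) :
    ∃ j ∈ J, ∀ g, π g j = j → π g iP = iP := by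
  refine exists_mem_forall_apply_eq_of_mem_span π ρ lam hperm hne hneg hpair hJ ?_ hnz
  have h : ⨅ j : ↥J, LinearMap.ker (lam (j : I)) ≤ LinearMap.ker (lam iP) := by
    intro w hw
    rw [LinearMap.mem_ker]
    refine hker w fun j hj ↦ ?_
    have hw' := (Submodule.mem_iInf _).1 hw ⟨j, hj⟩
    rwa [LinearMap.mem_ker] at hw'
  have hmem := mem_span_of_iInf_ker_le_ker h
  rwa [← Set.image_eq_range] at hmem

end Main

end Literature.RepresentationTheory.FiniteGroups
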